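import Literature.MathematicalPhysics.QuantumFieldTheory.Balaban1983to89.B6RandomWalkL2WindowV1
import Literature.MathematicalPhysics.QuantumFieldTheory.Balaban1983to89.B6RandomWalkL2TwoScaleMembers
import Literature.MathematicalPhysics.QuantumFieldTheory.Balaban1983to89.B6RandomWalkL2Grad2CubeV1

/-!
# `Balaban1983to89.B6RandomWalkL2Grad2LegV1` — T. Bałaban, *Propagators and renormalization transformations for lattice gauge theories. II*,
# Commun. Math. Phys. **96** (1984) 223–250 [Balaban1984PropagatorsII], (2.141) p. 247: THE FIRST LEG OF THE WALK FOR THE ENTRY `‖ζ∇∇GJ‖` OF (2.140),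
# PART 2 (THE BLOCK-`ℓ²` LEG): `∇_ν∇_μ(h_□G_□h_□)` has the block-`ℓ²` majorant `1_{□⁺}(y)·C·e^{−ρd_T(y,y′)}` — print's prefactor `1` for the fifth column
# of (2.140) (file 9 of the block-`ℓ²` bricks of `…B6RandomWalkL2`)

statement-level skeleton of published theorems with citation tags; proofs where landed; nothing here is a claim about the Yang–Mills mass gap

WHAT IS PRINTED (p. 247 [PDF 25]): (2.140) *"‖ζGJ‖, ‖ζ∇GJ‖, ‖ζG∇*J‖, ‖ζ∇G∇*J‖, ‖ζ∇∇GJ‖, ‖ζG∇*∇*J‖ ≤ O(1)[(Lʲη)², Lʲη, Lʲη, 1, 1, 1]e^{−δ₃d(y,y′)}|ζ|‖J‖"*;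
(2.141) *"G = G₀(I − R)⁻¹ = Σ_ω h_{□₀}G_{□₀}h_{□₀}·… and the series above is convergent in the norms appearing in the inequalities (2.136)–(2.140)"*; p. 246
Prop. 2.5: *"G_□ … satisfies all the inequalities (1.110)–(1.114)"* ([4] = [Balaban1984PropagatorsI], (1.114) p. 36: the six `L²` members, prefactors
`[(Lʲη)², Lʲη, Lʲη, 1, 1, 1]`).

CITATION HEADER (lean-in-tree rule) — WHAT IS REPRODUCED.  Phase-2 file of the `lit-balaban` typed skeleton (HOME `run/shared/lean/pub/lit-balaban/`), seat
**p22 gen 29** (free-target protocol G.5-34(d), TAKING HOME/STATUS 2026-08-24T13:26Z, cc r03/p38); SKELETON rows **B6.Prop2.6** × B6.Eq2.141 × B6.Prop2.5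
(cells only).  The `ℓ²` twin of p38's sup-norm first legs `…B6GradLegKLevelV1.hDG0_cube` / `…B6LapLegKLevelV1.hLapG0_cube`, for `∇_ν∇_μ`:
* §1 THE MEMBER INPUTS IN `ℓ²` ON THE CUBE: `inL2_cube_of_member` (ANY member operator `T′` with a block-`ℓ²` majorant `A·e^{−δ|y−y′|_{T_□}}` gives, for the
  conjugated scaled transplant `τ_{−v}(s(□)⁻¹•εT′ρ)τ_v`, `InL2Majorant (geomT D) (blkV1 hN D) (·) (Q^T_□) ((L^{d+1})²A e^{2δ/9}·(L^{j(y)}/c′)²·e^{−(δ/(9(d+1)))d_T})`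
  — r03's `hGin_cube` steps through `…B6RandomWalkL2WindowV1.inL2Decay_window_V1 / inL2Majorant_smul_of_le_on / inL2Majorant_conj_chart`), and its
  three instances **`hGin_l2_cube`** (`G_□`, (1.114)₁), **`hEGin_l2_cube`** (`E_(μ,+)G_□`, (1.114)₂), **`hEEGin_l2_cube`** (`E_(ν,+)E_(μ,+)G_□`, (1.114)₅) from
  `…B6RandomWalkL2TwoScaleMembers.ineq2140_G_TS / _DG_TS / _DDG_TS`;
* §2 `sq_size_scale_le` (on `□⁺`: `c′²·(C/(8S/5)²)·(L^{j(y)}/c′)² ≤ L⁴·C`, p38's `lap_scale_le` for any constant);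
* §3 **`hDDG0_l2_cube`** — THE FIRST `ℓ²` LEG OF (2.141) FOR `∇_ν∇_μG` PER CUBE: `ρ > 0`, `C ≥ 0` on `d, L, a₀, a₁` only with
  `HasL2Majorant (geomT D) (blkV1 hN D) (∇_ν·∇_μ·(h_□G_□h_□)) (1_{□⁺}(y)·1_{□⁺}(y′)·C·e^{−ρd_T(y,y′)})` on every admissible torus (`M_h = Lᵃ ≥ 8`, `R ≥ 2L²`,
  `P′ ≥ 5`, `L ≥ 5`, cube placed, `c′ ≠ 0`) — the four terms of `…B6RandomWalkL2Grad2CubeV1.DV_DV_sandwich_eq` through §1 with the sizes and supports of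
  the cut-off factors, the `ℓ²` sandwich `…B6RandomWalkL2WindowV1.hasL2Majorant_sandwich_in` and p38's scale lemmas `sq_scale_le`, `lip_scale_le`, `lin_scale_le`.
THEOREMS ONLY (no definition, no `def … : Prop`, no new hypothesis); IMPORTS BY NAME, restating nothing; standard axioms.

HONEST SCOPE / DIVERGENCES.  (1) ONE leg; the (2.140)₅ theorem for the genuine k-level `G` needs the gluing `…B6RandomWalkL2Gluing.prop26_2140_of_l2legs` with
the `ℓ²` pair bounds of `K_{□,□′}G_{□′}` ((2.134)/(2.135) and their transposes — p38's mirror files) and (2.91); next files.  (2) Constants carry `L⁴`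
(levels of `□⁺` ≤ `j₀ + 2`), print *"O(1) depending on d and L only"* — ours depend on `a₀, a₁` too; the `M⁻¹`, `M⁻²` gains of the cut-off terms are given
away.  (3) Unweighted `ℓ²` on the fine bonds of the k-level V1 torus, lattice units.  (4) Toward the unowned census slot (2.140)₅ (₆ by transposition,
`…B6RandomWalkL2Schur.hasL2Majorant_transpose`); NOT that slot.  NOT summit progress.  Unit `lit-balaban-p22` (gen 29), 2026-08-24.
-/

noncomputable section

open scoped BigOperators
open Finset

namespace Literature.MathematicalPhysics.QuantumFieldTheory.Balaban1983to89.B6RandomWalkL2Grad2LegV1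

open LatticeFieldCalculus
open B5Eq118OneStroke (iterBlockOf)
open B6MultiLevelBoxOperator (N0 bigSide)
open B6MultiLevelTorusOperator (TDomains)
open B6Cover236MultiLevelBlocks (cubes)
open B6Geom246MultiLevelTorus (geomT)
open B8Ineq192MultiLevelTorus (geomT_len)
open B6Eq238MultiLevelTorus (svec)
open B6RandomWalk (blockPiece)
open B6RandomWalkL2 (l2n l2n_nonneg l2n_zero l2n_smul l2n_mono HasL2Majorant hasL2Majorant_mono hasL2Majorant_add)
open B6RandomWalkL2Transplant (InL2Majorant inL2Majorant_mono)
open B6RandomWalkL2WindowV1 (inL2Decay_window_V1 inL2Majorant_smul_of_le_on inL2Majorant_conj_chart inL2Majorant_congr_set blockPiece_smul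
  hasL2Majorant_smul hasL2Majorant_sandwich_in)
open B6RandomWalkL2TwoScaleMembers (ineq2140_G_TS ineq2140_DG_TS ineq2140_DDG_TS)
open B6Prop26Gluing (mulOp mulOp_apply ind ind_nonneg ind_le_one ind_of_mem ind_of_not_mem)
open B6Ineq2133TwoScaleV1 (onFun tsGeo)
open B6Prop26ReachTransplant (transplant transplant_mul_of_bij)
open B6GlobalChartV1 (PV toBox blkV1 domT)
open B6AgreeLapV1Chart (cB eB onFun_comp)
open B6Prop25TwoScaleCensus (TSIdx)
open B6SectAOperatorsV1 (BondIdx)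
open B6TranslateTorusV1 (vch TB kernel_blkMap)
open B6Partition118KLevelFineSizes (C1F C1F_nonneg)
open B6Partition118KLevelTorusCentral (one_le_of_four_le)
open B6Partition118KLevelFineMixed (C2X C2X_bounds)
open B6Prop26KLevelSkeletonV1 (hB ST mem_ST pref pref_nonneg abs_hB_le_one blkV1_mem_QT_of_hB_ne_zero)
open B6CubeWindowV1 (tC x0 hx0 hfit wC Placed j0 j0_le_level Gl sc SQ mem_blkMap_image_SQ)
open B6Eq292MemberTorusV1 (EC)
open B6CubeInDecayV1 (conj_mul Gl_eq hdiv_cube hlev_full hband_cube sc_inv_le_pref transplant_off sc_nonneg smul_kernel_le)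
open B6CubeCoeffSizesV1 (level_le_of_mem_QT)
open B6GradLegKLevelV1 (shB shB_apply DV EC_true lip_scale_le)
open B6LapLegKLevelV1 (sq_scale_le lin_scale_le)
open B6RandomWalkL2Grad2CubeV1 (abs_DV_DV_hB_le abs_DV_shB_hB_le abs_shB_DV_hB_le DV_DV_hB_support DV_shB_hB_support shB_DV_hB_support
  shB_shB_hB_support EC_mul_EC_mul_Gl_eq DV_DV_sandwich_eq)

/-! ## §1  The member inputs in `ℓ²` on the cube: `G_□`, `E_(μ,+)G_□`, `E_(ν,+)E_(μ,+)G_□` input-localised over `Q^T_□` with global decay -/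

section Cube

variable {d ℓ : ℕ} {hd : 1 ≤ d + 1} {hL : Odd (ℓ + 1) ∧ 1 < ℓ + 1} {a₀ a₁ : ℝ} {m K : ℕ} {Mh k R : ℕ} {P' : Fin (d + 1) → ℕ}
variable (hN : ∀ μ, N0 ℓ Mh k P' μ = (PV d ℓ m K hd hL).sitesPerDir 0) {D : TDomains d ℓ Mh k P' R} (hk : k ≤ m + K)
  (hMh1 : 1 ≤ Mh) (hP4 : ∀ μ, 4 ≤ P' μ) {a : ℕ} (hMha : Mh = (ℓ + 1) ^ a) (c : ↥(cubes D.toDomains)) (ha : a₀ ≤ a₁)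

include hMha in
/-- **ANY MEMBER OPERATOR WITH A BLOCK-`ℓ²` MAJORANT `A·e^{−δ|y−y′|_{T_□}}` ON `T_□`, CONJUGATED-SCALED-TRANSPLANTED TO THE CUBE**, has
`InL2Majorant (geomT D) (blkV1 hN D) (τ_{−v}(s(□)⁻¹•εT′ρ)τ_v) (Q^T_□) ((L^{d+1})²A e^{2δ/9}·(L^{j(y)}/c′)²·e^{−(δ/(9(d+1)))d_T})` (`L ≥ 5`; r03's `hGin_cube`
steps in `ℓ²`: band bridge, the unit `s(□)⁻¹ ≤ (L^{j(y)}/c′)²` on the window, the chart translation, the reach as block-map image).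
[cite: Balaban1984PropagatorsII, (2.133) p.247, (2.140)–(2.141) p.247, (2.90)–(2.94) p.239, p.238 (T_□ = □̃³)] -/
theorem inL2_cube_of_member {A δ : ℝ} (hA : 0 ≤ A) (hδ : 0 ≤ δ) (hMh : 2 ≤ Mh) (hR2 : 2 * (ℓ + 1) ^ 2 ≤ R) (hℓ : 4 ≤ ℓ)
    (hpl : Placed ℓ k P' c.1) (w : BondIdx (domT hN D hk) → ℝ) (cf : ℝ)
    {T' : Module.End ℝ (PBond (tC hN hk hMh1 hP4 c ha a (wC hN hk c w) cf).P 0 → ℝ)}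
    (hT' : HasL2Majorant (g := tsGeo (tC hN hk hMh1 hP4 c ha a (wC hN hk c w) cf) 0 0)
      (fun b : PBond (tC hN hk hMh1 hP4 c ha a (wC hN hk c w) cf).P 0 => iterBlockOf (tC hN hk hMh1 hP4 c ha a (wC hN hk c w) cf).j b.src) T'
      (fun y y' => A * Real.exp (-(δ * (tC hN hk hMh1 hP4 c ha a (wC hN hk c w) cf).tdist y y')))) :
    InL2Majorant (g := geomT D) (blkV1 hN D)
      (TB (-vch Mh k (svec ℓ k c.1.1 c.1.2)) *
        ((sc hMh1 hP4 c cf)⁻¹ • transplant (cB (tC hN hk hMh1 hP4 c ha a (wC hN hk c w) cf) (x0 ℓ Mh k c.1) (hx0 hpl) (hfit hN hMh1 hP4 hMha c ha hpl)).W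
          (eB (tC hN hk hMh1 hP4 c ha a (wC hN hk c w) cf) (x0 ℓ Mh k c.1)) T') *
        TB (vch Mh k (svec ℓ k c.1.1 c.1.2)))
      (ST D hMh1 hP4 c)
      (fun y y' => (((ℓ + 1) ^ (d + 1) : ℕ) : ℝ) ^ 2 * (A * Real.exp (δ * (((d : ℝ) + 1) + ((d : ℝ) + 1)) / (((d : ℝ) + 1) * ((9 : ℕ) : ℝ)))) *
        pref cf y * Real.exp (-(δ / (((d : ℝ) + 1) * ((9 : ℕ) : ℝ)) * (geomT D).dist y y'))) := by
  have hP : ∀ μ, 1 ≤ P' μ := one_le_of_four_le hP4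
  -- the band bridge in the chart frame
  have h1 := inL2Decay_window_V1 (t := tC hN hk hMh1 hP4 c ha a (wC hN hk c w) cf) (x₀ := x0 ℓ Mh k c.1) (hx₀ := hx0 hpl)
    (hfit := hfit hN hMh1 hP4 hMha c ha hpl) hN (D.chart (svec ℓ k c.1.1 c.1.2)) hA hδ hT' hMh1 hP
    (hdiv_cube hN hk hMh1 hP4 c ha (wC hN hk c w) cf) (hlev_full hN hk hMh1 hP4 hMha c ha hR2 (wC hN hk c w) cf) (C := 9) (by norm_num)
    (SQ hMh1 hP4 c) (fun b _ hbS => hband_cube hN hk hMh1 hP4 hMha c ha hℓ hMh hR2 (wC hN hk c w) cf b hbS)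
  -- the unit `s(□)⁻¹ ≤ (L^{j(y)}/c′)²` on the window
  have h2 := inL2Majorant_smul_of_le_on (blkV1 hN (D.chart (svec ℓ k c.1.1 c.1.2))) h1 _
    (transplant_off hN hk hMh1 hP4 hMha c ha hpl (wC hN hk c w) cf _) (inv_nonneg.2 (sc_nonneg hMh1 hP4 c cf))
    (K' := fun y y' => (((ℓ + 1) ^ (d + 1) : ℕ) : ℝ) ^ 2 * (A * Real.exp (δ * (((d : ℝ) + 1) + ((d : ℝ) + 1)) / (((d : ℝ) + 1) * ((9 : ℕ) : ℝ)))) *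
      pref cf y * Real.exp (-(δ / (((d : ℝ) + 1) * ((9 : ℕ) : ℝ)) * (geomT (D.chart (svec ℓ k c.1.1 c.1.2))).dist y y')))
    (fun a b => by have := pref_nonneg cf a; positivity)
    (fun b hb y _ => smul_kernel_le (sc_inv_le_pref hN hk hMh1 hP4 hMha c ha hR2 hpl (wC hN hk c w) cf hb) (by positivity) (by positivity)
      (Real.exp_nonneg _))
  -- back to the global frame along the chart translation; the reach `Q^T_□` is the block-map image of `□⁺`
  have h3 := inL2Majorant_conj_chart hN D hMh1 hP (svec ℓ k c.1.1 c.1.2) h2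
    (K' := fun y y' => (((ℓ + 1) ^ (d + 1) : ℕ) : ℝ) ^ 2 * (A * Real.exp (δ * (((d : ℝ) + 1) + ((d : ℝ) + 1)) / (((d : ℝ) + 1) * ((9 : ℕ) : ℝ)))) *
      pref cf y * Real.exp (-(δ / (((d : ℝ) + 1) * ((9 : ℕ) : ℝ)) * (geomT D).dist y y')))
    (fun a b => le_of_eq (kernel_blkMap D hMh1 hP (svec ℓ k c.1.1 c.1.2) (fun n => ((((ℓ + 1 : ℕ) : ℝ)) ^ n / cf) ^ 2) _ _ a b))
    (fun a b => by have := pref_nonneg cf a; positivity)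
  exact inL2Majorant_congr_set _ (mem_blkMap_image_SQ hMh1 hP4 c) h3

/-- **`hGin` IN `ℓ²`: THE GENUINE `G_□` OF THE CUBE** has `InL2Majorant (geomT D) (blkV1 hN D) (G_□) (Q^T_□) (C_G·(L^{j(y)}/c′)²·e^{−δ_G d_T})`, one
`(δ_G, C_G)` on `d, L, a₀, a₁` for all cubes — the member (1.114)₁ (`ineq2140_G_TS`) through `inL2_cube_of_member`.
[cite: Balaban1984PropagatorsII, Prop. 2.5 p.246, (2.133) + (2.140)–(2.141) p.247; Balaban1984PropagatorsI, (1.114) p.36] -/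
theorem hGin_l2_cube (d ℓ : ℕ) (hd : 1 ≤ d + 1) (hL : Odd (ℓ + 1) ∧ 1 < ℓ + 1) {a₀ a₁ : ℝ} (ha₀ : 0 < a₀) (ha₁ : a₀ ≤ a₁) :
    ∃ δG : ℝ, 0 < δG ∧ ∃ CG : ℝ, 0 ≤ CG ∧ ∀ (m K : ℕ) {Mh k R : ℕ} {P' : Fin (d + 1) → ℕ}
      (hN : ∀ μ, N0 ℓ Mh k P' μ = (PV d ℓ m K hd hL).sitesPerDir 0) (D : TDomains d ℓ Mh k P' R) (hk : k ≤ m + K)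
      (hMh1 : 1 ≤ Mh) (hP4 : ∀ μ, 4 ≤ P' μ) {a : ℕ} (hMha : Mh = (ℓ + 1) ^ a) (_ : 2 ≤ Mh) (_ : 2 * (ℓ + 1) ^ 2 ≤ R) (_ : 4 ≤ ℓ)
      (c : ↥(cubes D.toDomains)) (hpl : Placed ℓ k P' c.1) (w : BondIdx (domT hN D hk) → ℝ) (cf : ℝ),
      InL2Majorant (g := geomT D) (blkV1 hN D) (Gl hN hk hMh1 hP4 hMha c ha₁ hpl w cf) (ST D hMh1 hP4 c)
        (fun y y' => CG * pref cf y * Real.exp (-(δG * (geomT D).dist y y'))) := by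
  obtain ⟨δ, hδ, A, hA, hmem⟩ := ineq2140_G_TS d (ℓ + 1) hd hL ha₀ ha₁
  refine ⟨δ / (((d : ℝ) + 1) * ((9 : ℕ) : ℝ)), by positivity,
    (((ℓ + 1) ^ (d + 1) : ℕ) : ℝ) ^ 2 * (A * Real.exp (δ * (((d : ℝ) + 1) + ((d : ℝ) + 1)) / (((d : ℝ) + 1) * ((9 : ℕ) : ℝ)))), by positivity, ?_⟩
  intro m K Mh k R P' hN D hk hMh1 hP4 a hMha hMh hR2 hℓ c hpl w cf
  rw [Gl_eq]
  exact inL2_cube_of_member hN hk hMh1 hP4 hMha c ha₁ hA hδ.le hMh hR2 hℓ hpl w cf (hmem _ 0 0)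

/-- **`hEG` IN `ℓ²`: THE LEG `E_(μ,+)G_□` OF THE CUBE** (`∇_μG_□` transplanted) has `InL2Majorant … (E_(μ,+)G_□) (Q^T_□) (C·(L^{j(y)}/c′)²·e^{−δ_G d_T})`
— the member (1.114)₂ (`ineq2140_DG_TS`) through `inL2_cube_of_member`.
[cite: Balaban1984PropagatorsII, Prop. 2.5 p.246, (2.92) p.239 (line 1), (2.133) + (2.140)–(2.141) p.247; Balaban1984PropagatorsI, (1.114) p.36] -/
theorem hEGin_l2_cube (d ℓ : ℕ) (hd : 1 ≤ d + 1) (hL : Odd (ℓ + 1) ∧ 1 < ℓ + 1) {a₀ a₁ : ℝ} (ha₀ : 0 < a₀) (ha₁ : a₀ ≤ a₁) :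
    ∃ δG : ℝ, 0 < δG ∧ ∃ CG : ℝ, 0 ≤ CG ∧ ∀ (m K : ℕ) {Mh k R : ℕ} {P' : Fin (d + 1) → ℕ}
      (hN : ∀ μ, N0 ℓ Mh k P' μ = (PV d ℓ m K hd hL).sitesPerDir 0) (D : TDomains d ℓ Mh k P' R) (hk : k ≤ m + K)
      (hMh1 : 1 ≤ Mh) (hP4 : ∀ μ, 4 ≤ P' μ) {a : ℕ} (hMha : Mh = (ℓ + 1) ^ a) (_ : 2 ≤ Mh) (_ : 2 * (ℓ + 1) ^ 2 ≤ R) (_ : 4 ≤ ℓ)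
      (c : ↥(cubes D.toDomains)) (hpl : Placed ℓ k P' c.1) (w : BondIdx (domT hN D hk) → ℝ) (cf : ℝ) (μ : Fin (d + 1)),
      InL2Majorant (g := geomT D) (blkV1 hN D) (EC hN hk hMh1 hP4 hMha c ha₁ hpl w cf (μ, true) * Gl hN hk hMh1 hP4 hMha c ha₁ hpl w cf)
        (ST D hMh1 hP4 c) (fun y y' => CG * pref cf y * Real.exp (-(δG * (geomT D).dist y y'))) := by
  obtain ⟨δ, hδ, A, hA, hmem⟩ := ineq2140_DG_TS d (ℓ + 1) hd hL ha₀ ha₁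
  refine ⟨δ / (((d : ℝ) + 1) * ((9 : ℕ) : ℝ)), by positivity,
    (((ℓ + 1) ^ (d + 1) : ℕ) : ℝ) ^ 2 * (A * Real.exp (δ * (((d : ℝ) + 1) + ((d : ℝ) + 1)) / (((d : ℝ) + 1) * ((9 : ℕ) : ℝ)))), by positivity, ?_⟩
  intro m K Mh k R P' hN D hk hMh1 hP4 a hMha hMh hR2 hℓ c hpl w cf μ
  -- `E_(μ,+)G_□ = τ_{−v}(s⁻¹•ε(∇_μG_□)ρ)τ_v` through the bijective window
  have e : EC hN hk hMh1 hP4 hMha c ha₁ hpl w cf (μ, true) * Gl hN hk hMh1 hP4 hMha c ha₁ hpl w cf = TB (-vch Mh k (svec ℓ k c.1.1 c.1.2)) *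
      ((sc hMh1 hP4 c cf)⁻¹ • transplant (cB (tC hN hk hMh1 hP4 c ha₁ a (wC hN hk c w) cf) (x0 ℓ Mh k c.1) (hx0 hpl) (hfit hN hMh1 hP4 hMha c ha₁ hpl)).W
        (eB (tC hN hk hMh1 hP4 c ha₁ a (wC hN hk c w) cf) (x0 ℓ Mh k c.1))
        (onFun ((tC hN hk hMh1 hP4 c ha₁ a (wC hN hk c w) cf).Dl μ ∘ₗ (tC hN hk hMh1 hP4 c ha₁ a (wC hN hk c w) cf).D.G))) *
      TB (vch Mh k (svec ℓ k c.1.1 c.1.2)) := by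
    rw [EC_true, Gl_eq, conj_mul, mul_smul_comm, onFun_comp, ← Module.End.mul_eq_comp,
      transplant_mul_of_bij (W := (cB (tC hN hk hMh1 hP4 c ha₁ a (wC hN hk c w) cf) (x0 ℓ Mh k c.1) (hx0 hpl) (hfit hN hMh1 hP4 hMha c ha₁ hpl)).W)
        (e := eB (tC hN hk hMh1 hP4 c ha₁ a (wC hN hk c w) cf) (x0 ℓ Mh k c.1))
        (cB (tC hN hk hMh1 hP4 c ha₁ a (wC hN hk c w) cf) (x0 ℓ Mh k c.1) (hx0 hpl) (hfit hN hMh1 hP4 hMha c ha₁ hpl)).inj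
        (cB (tC hN hk hMh1 hP4 c ha₁ a (wC hN hk c w) cf) (x0 ℓ Mh k c.1) (hx0 hpl) (hfit hN hMh1 hP4 hMha c ha₁ hpl)).surj]
  rw [e]
  exact inL2_cube_of_member hN hk hMh1 hP4 hMha c ha₁ hA hδ.le hMh hR2 hℓ hpl w cf (hmem _ 0 0 μ)

/-- **`hEEG` IN `ℓ²`: THE LEG `E_(ν,+)E_(μ,+)G_□` OF THE CUBE** (`∇_ν∇_μG_□` transplanted) has `InL2Majorant … (Q^T_□) (C·(L^{j(y)}/c′)²·e^{−δ_G d_T})` —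
the SINGULAR member (1.114)₅ (`ineq2140_DDG_TS`, no sup majorant exists) through `inL2_cube_of_member`.
[cite: Balaban1984PropagatorsII, Prop. 2.5 p.246, (2.133) + (2.140)–(2.141) p.247; Balaban1984PropagatorsI, (1.114) p.36] -/
theorem hEEGin_l2_cube (d ℓ : ℕ) (hd : 1 ≤ d + 1) (hL : Odd (ℓ + 1) ∧ 1 < ℓ + 1) {a₀ a₁ : ℝ} (ha₀ : 0 < a₀) (ha₁ : a₀ ≤ a₁) :
    ∃ δG : ℝ, 0 < δG ∧ ∃ CG : ℝ, 0 ≤ CG ∧ ∀ (m K : ℕ) {Mh k R : ℕ} {P' : Fin (d + 1) → ℕ}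
      (hN : ∀ μ, N0 ℓ Mh k P' μ = (PV d ℓ m K hd hL).sitesPerDir 0) (D : TDomains d ℓ Mh k P' R) (hk : k ≤ m + K)
      (hMh1 : 1 ≤ Mh) (hP4 : ∀ μ, 4 ≤ P' μ) {a : ℕ} (hMha : Mh = (ℓ + 1) ^ a) (_ : 2 ≤ Mh) (_ : 2 * (ℓ + 1) ^ 2 ≤ R) (_ : 4 ≤ ℓ)
      (c : ↥(cubes D.toDomains)) (hpl : Placed ℓ k P' c.1) (w : BondIdx (domT hN D hk) → ℝ) (cf : ℝ) (ν μ : Fin (d + 1)),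
      InL2Majorant (g := geomT D) (blkV1 hN D)
        (EC hN hk hMh1 hP4 hMha c ha₁ hpl w cf (ν, true) * (EC hN hk hMh1 hP4 hMha c ha₁ hpl w cf (μ, true) * Gl hN hk hMh1 hP4 hMha c ha₁ hpl w cf))
        (ST D hMh1 hP4 c) (fun y y' => CG * pref cf y * Real.exp (-(δG * (geomT D).dist y y'))) := by
  obtain ⟨δ, hδ, A, hA, hmem⟩ := ineq2140_DDG_TS d (ℓ + 1) hd hL ha₀ ha₁
  refine ⟨δ / (((d : ℝ) + 1) * ((9 : ℕ) : ℝ)), by positivity,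
    (((ℓ + 1) ^ (d + 1) : ℕ) : ℝ) ^ 2 * (A * Real.exp (δ * (((d : ℝ) + 1) + ((d : ℝ) + 1)) / (((d : ℝ) + 1) * ((9 : ℕ) : ℝ)))), by positivity, ?_⟩
  intro m K Mh k R P' hN D hk hMh1 hP4 a hMha hMh hR2 hℓ c hpl w cf ν μ
  rw [EC_mul_EC_mul_Gl_eq]
  exact inL2_cube_of_member hN hk hMh1 hP4 hMha c ha₁ hA hδ.le hMh hR2 hℓ hpl w cf (hmem _ 0 0 ν μ)

end Cube

/-! ## §2  One more scale fact of `□⁺`: `c′²·(C/(8S/5)²)·(L^{j(y)}/c′)² ≤ L⁴·C` -/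

section Scale

variable {d ℓ : ℕ} {hd : 1 ≤ d + 1} {hL : Odd (ℓ + 1) ∧ 1 < ℓ + 1} {m K : ℕ} {Mh k R : ℕ} {P' : Fin (d + 1) → ℕ}

/-- on `□⁺`: `c′²·(C/(8S/5)²)·(L^{j(y)}/c′)² ≤ L⁴·C` for `C ≥ 0` (`L^{j₀} ≤ 8S/5`, `j(y) ≤ j₀ + 2`; p38's `lap_scale_le` for any constant).
[cite: Balaban1984PropagatorsII, p.247 (sizes of the derivatives of h_□), (2.94) p.239, bookkeeping] -/
theorem sq_size_scale_le (hL : Odd (ℓ + 1) ∧ 1 < ℓ + 1) {D : TDomains d ℓ Mh k P' R} (hMh1 : 1 ≤ Mh) (hP4 : ∀ μ, 4 ≤ P' μ)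
    (c : ↥(cubes D.toDomains)) (hR2 : 2 * (ℓ + 1) ^ 2 ≤ R) {cf : ℝ} (hcf : cf ≠ 0) {y : (geomT D).Site} (hy : y ∈ ST D hMh1 hP4 c) {C : ℝ}
    (hC : 0 ≤ C) :
    cf ^ 2 * (C / (8 / 5 * (bigSide ℓ Mh c.1.1 : ℝ)) ^ 2) * pref cf y ≤ (((ℓ + 1 : ℕ) : ℝ)) ^ 4 * C := by
  have hR : 2 * (ℓ + 1) ≤ R := le_trans (by nlinarith : 2 * (ℓ + 1) ≤ 2 * (ℓ + 1) ^ 2) hR2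
  have hlev : y.1.1 ≤ j0 hMh1 hP4 c + 2 := by
    have h1 := level_le_of_mem_QT hMh1 hP4 c hR ((mem_ST D hMh1 hP4 c y).1 hy)
    have h2 := (j0_le_level hMh1 hP4 c hL hR2).2
    omega
  have hL1 : (1 : ℝ) ≤ ((ℓ + 1 : ℕ) : ℝ) := by exact_mod_cast Nat.succ_pos ℓ
  have hpow : (((ℓ + 1 : ℕ) : ℝ)) ^ (y.1.1 : ℕ) ≤ (((ℓ + 1 : ℕ) : ℝ)) ^ 2 * (((ℓ + 1 : ℕ) : ℝ)) ^ j0 hMh1 hP4 c := by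
    rw [← pow_add]; exact pow_le_pow_right₀ hL1 (by omega)
  have hj0 : (0 : ℝ) < (((ℓ + 1 : ℕ) : ℝ)) ^ j0 hMh1 hP4 c := by positivity
  have hS : (((ℓ + 1 : ℕ) : ℝ)) ^ j0 hMh1 hP4 c ≤ 8 / 5 * (bigSide ℓ Mh c.1.1 : ℝ) := by
    have hj := (j0_le_level hMh1 hP4 c hL hR2).1
    unfold bigSide; push_cast
    have hL1' : (1 : ℝ) ≤ (ℓ : ℝ) + 1 := by linarith [Nat.cast_nonneg (α := ℝ) ℓ]
    have hM : (1 : ℝ) ≤ Mh := by exact_mod_cast hMh1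
    have h1 : ((ℓ : ℝ) + 1) ^ j0 hMh1 hP4 c ≤ ((ℓ : ℝ) + 1) ^ (c.1.1 + 1) := pow_le_pow_right₀ hL1' (by omega)
    have h2 : ((ℓ : ℝ) + 1) ^ (c.1.1 + 1) ≤ (Mh : ℝ) * ((ℓ : ℝ) + 1) ^ (c.1.1 + 1) := le_mul_of_one_le_left (by positivity) hM
    nlinarith [pow_nonneg (by positivity : (0:ℝ) ≤ (ℓ : ℝ) + 1) (c.1.1 + 1)]
  have hS0 : (0 : ℝ) < 8 / 5 * (bigSide ℓ Mh c.1.1 : ℝ) := lt_of_lt_of_le hj0 hS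
  unfold pref
  have e : cf ^ 2 * (C / (8 / 5 * (bigSide ℓ Mh c.1.1 : ℝ)) ^ 2) * ((((ℓ + 1 : ℕ) : ℝ)) ^ (y.1.1 : ℕ) / cf) ^ 2 =
      C * ((((ℓ + 1 : ℕ) : ℝ)) ^ (y.1.1 : ℕ) / (8 / 5 * (bigSide ℓ Mh c.1.1 : ℝ))) ^ 2 := by
    field_simp
  rw [e, mul_comm ((((ℓ + 1 : ℕ) : ℝ)) ^ 4)]
  refine mul_le_mul_of_nonneg_left ?_ hC
  have hrat : (((ℓ + 1 : ℕ) : ℝ)) ^ (y.1.1 : ℕ) / (8 / 5 * (bigSide ℓ Mh c.1.1 : ℝ)) ≤ (((ℓ + 1 : ℕ) : ℝ)) ^ 2 :=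
    (div_le_iff₀ hS0).2 (hpow.trans (mul_le_mul_of_nonneg_left hS (by positivity)))
  rw [show ((((ℓ + 1 : ℕ) : ℝ)) ^ 4) = ((((ℓ + 1 : ℕ) : ℝ)) ^ 2) ^ 2 by ring]
  exact pow_le_pow_left₀ (by positivity) hrat 2

end Scale

/-! ## §3  THE FIRST `ℓ²` LEG OF (2.141) FOR `∇_ν∇_μG`, PER CUBE -/

section Leg

variable {d ℓ : ℕ} {hd : 1 ≤ d + 1} {hL : Odd (ℓ + 1) ∧ 1 < ℓ + 1} {m K : ℕ} {Mh k R : ℕ} {P' : Fin (d + 1) → ℕ}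

/-- **THE FIRST LEG OF (2.141) FOR THE ENTRY `‖ζ∇∇GJ‖` OF (2.140), PER CUBE, FOR THE GENUINE MEMBER, IN `ℓ²`** (`L ≥ 5`): there are `ρ > 0`, `C ≥ 0`
(on `d, L` and the weight band `[a₀, a₁]` only) such that on every admissible V1 torus (`M_h = Lᵃ ≥ 8`, `R ≥ 2L²`, `P′ ≥ 5`, cube placed), for every
`c′ ≠ 0`, weights `w`, directions `ν, μ` and cube `□`:
`HasL2Majorant (geomT D) (blkV1 hN D) (∇_ν·∇_μ·(h_□G_□h_□)) (1_{□⁺}(y)·1_{□⁺}(y′)·C·e^{−ρ d_T(y,y′)})` — print's `O(1)·1·e^{−δd}` for the first leg of the fifth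
column of (2.140), from the member's (1.114)₁,₂,₅ in `ℓ²` (§1) and the sizes of `∇h_□`, `∇∇h_□`.
[cite: Balaban1984PropagatorsII, Prop. 2.6 (2.140)–(2.141) p.247 («‖ζ∇∇GJ‖ ≤ O(1)·1·e^{−δ₃d}|ζ|‖J‖»), Prop. 2.5 p.246, (2.92) p.239 line 1; Balaban1984PropagatorsI, (1.114) p.36] -/
theorem hDDG0_l2_cube (d ℓ : ℕ) (hd : 1 ≤ d + 1) (hL : Odd (ℓ + 1) ∧ 1 < ℓ + 1) {a₀ a₁ : ℝ} (ha₀ : 0 < a₀) (ha₁ : a₀ ≤ a₁) :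
    ∃ ρD : ℝ, 0 < ρD ∧ ∃ CD : ℝ, 0 ≤ CD ∧ ∀ (m K : ℕ) {Mh k R : ℕ} {P' : Fin (d + 1) → ℕ}
      (hN : ∀ μ, N0 ℓ Mh k P' μ = (PV d ℓ m K hd hL).sitesPerDir 0) (D : TDomains d ℓ Mh k P' R) (hk : k ≤ m + K)
      (hMh1 : 1 ≤ Mh) (hP4 : ∀ μ, 4 ≤ P' μ) {a : ℕ} (hMha : Mh = (ℓ + 1) ^ a) (_ : 8 ≤ Mh) (_ : 2 * (ℓ + 1) ^ 2 ≤ R) (_ : ∀ μ, 5 ≤ P' μ)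
      (_ : 4 ≤ ℓ) (c : ↥(cubes D.toDomains)) (hpl : Placed ℓ k P' c.1) (w : BondIdx (domT hN D hk) → ℝ) {cf : ℝ} (_ : cf ≠ 0) (ν μ : Fin (d + 1)),
      HasL2Majorant (g := geomT D) (blkV1 hN D)
        (DV ν cf * (DV μ cf * (mulOp (hB hN D c) * Gl hN hk hMh1 hP4 hMha c ha₁ hpl w cf * mulOp (hB hN D c))))
        (fun y y' => ind (ST D hMh1 hP4 c) y * ind (ST D hMh1 hP4 c) y' * (CD * Real.exp (-(ρD * (geomT D).dist y y')))) := by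
  obtain ⟨ρG, hρG, CG, hCG, hGin⟩ := hGin_l2_cube d ℓ hd hL ha₀ ha₁
  obtain ⟨ρE, hρE, CE, hCE, hEGin⟩ := hEGin_l2_cube d ℓ hd hL ha₀ ha₁
  obtain ⟨ρ2, hρ2, C2, hC2, hEEGin⟩ := hEEGin_l2_cube d ℓ hd hL ha₀ ha₁
  have hC1 := C1F_nonneg d ℓ
  obtain ⟨-, -, hC2X⟩ := C2X_bounds d ℓ
  refine ⟨min ρG (min ρE ρ2), lt_min hρG (lt_min hρE hρ2),
    (((ℓ + 1 : ℕ) : ℝ)) ^ 4 * C2 + ((((ℓ + 1 : ℕ) : ℝ)) ^ 4 * C1F d ℓ * CE + (((ℓ + 1 : ℕ) : ℝ)) ^ 4 * C1F d ℓ * CE) +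
      (((ℓ + 1 : ℕ) : ℝ)) ^ 4 * C2X d ℓ * CG, by positivity, ?_⟩
  intro m K Mh k R P' hN D hk hMh1 hP4 a hMha hM8 hR2 hP5 hℓ c hpl w cf hcf ν μ
  have hMh : 2 ≤ Mh := le_trans (by norm_num) hM8
  have hR : 2 * (ℓ + 1) ≤ R := le_trans (by nlinarith : 2 * (ℓ + 1) ≤ 2 * (ℓ + 1) ^ 2) hR2
  have hP : ∀ μ, 1 ≤ P' μ := one_le_of_four_le hP4
  have hdnn : ∀ y y' : (geomT D).Site, 0 ≤ (geomT D).dist y y' := fun _ _ => Nat.cast_nonneg _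
  -- the three input-localised member legs in `ℓ²`
  have h2 := hEEGin m K hN D hk hMh1 hP4 hMha hMh hR2 hℓ c hpl w cf ν μ
  have hEμ := hEGin m K hN D hk hMh1 hP4 hMha hMh hR2 hℓ c hpl w cf μ
  have hEν := hEGin m K hN D hk hMh1 hP4 hMha hMh hR2 hℓ c hpl w cf ν
  have hG := hGin m K hN D hk hMh1 hP4 hMha hMh hR2 hℓ c hpl w cf
  -- term 1: `(S_νS_μh_□)·(E_νE_μG_□)·h_□`
  have hT1 := hasL2Majorant_sandwich_in (g := geomT D) (blkV1 hN D) (S := ST D hMh1 hP4 c) (s := 1)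
    (f := shB ν (shB μ (hB hN D c))) (h := hB hN D c)
    (K := fun y y' => C2 * pref cf y * Real.exp (-(ρ2 * (geomT D).dist y y')))
    (fun y y' => by have := pref_nonneg cf y; positivity) zero_le_one
    (fun b hb => shB_shB_hB_support hN hMh1 hP4 c hM8 hR hP5 ν μ hb)
    (fun b => by rw [shB_apply, shB_apply]; exact abs_hB_le_one hN D hMh1 hP c _)
    (fun b hb => (mem_ST D hMh1 hP4 c _).2 (blkV1_mem_QT_of_hB_ne_zero hN D hMh hR hP4 c hb))
    (fun b => abs_hB_le_one hN D hMh1 hP c b) h2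
  -- term 2: `(∇_ν(S_μh_□))·(E_μG_□)·h_□`
  have hT2 := hasL2Majorant_sandwich_in (g := geomT D) (blkV1 hN D) (S := ST D hMh1 hP4 c)
    (s := |cf| * (C1F d ℓ / (8 / 5 * (bigSide ℓ Mh c.1.1 : ℝ))))
    (f := DV ν cf (shB μ (hB hN D c))) (h := hB hN D c)
    (K := fun y y' => CE * pref cf y * Real.exp (-(ρE * (geomT D).dist y y')))
    (fun y y' => by have := pref_nonneg cf y; positivity) (by positivity)
    (fun b hb => DV_shB_hB_support hN hMh1 hP4 c hM8 hR hP5 cf ν μ hb)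
    (fun b => abs_DV_shB_hB_le hN c hMh hR hP5 cf ν μ b)
    (fun b hb => (mem_ST D hMh1 hP4 c _).2 (blkV1_mem_QT_of_hB_ne_zero hN D hMh hR hP4 c hb))
    (fun b => abs_hB_le_one hN D hMh1 hP c b) hEμ
  -- term 3: `(S_ν(∇_μh_□))·(E_νG_□)·h_□`
  have hT3 := hasL2Majorant_sandwich_in (g := geomT D) (blkV1 hN D) (S := ST D hMh1 hP4 c)
    (s := |cf| * (C1F d ℓ / (8 / 5 * (bigSide ℓ Mh c.1.1 : ℝ))))
    (f := shB ν (DV μ cf (hB hN D c))) (h := hB hN D c)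
    (K := fun y y' => CE * pref cf y * Real.exp (-(ρE * (geomT D).dist y y')))
    (fun y y' => by have := pref_nonneg cf y; positivity) (by positivity)
    (fun b hb => shB_DV_hB_support hN hMh1 hP4 c hM8 hR hP5 cf ν μ hb)
    (fun b => abs_shB_DV_hB_le hN c hMh hR hP5 cf ν μ b)
    (fun b hb => (mem_ST D hMh1 hP4 c _).2 (blkV1_mem_QT_of_hB_ne_zero hN D hMh hR hP4 c hb))
    (fun b => abs_hB_le_one hN D hMh1 hP c b) hEν
  -- term 4: `(∇_ν∇_μh_□)·G_□·h_□`
  have hT4 := hasL2Majorant_sandwich_in (g := geomT D) (blkV1 hN D) (S := ST D hMh1 hP4 c)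
    (s := cf ^ 2 * (C2X d ℓ / (8 / 5 * (bigSide ℓ Mh c.1.1 : ℝ)) ^ 2))
    (f := DV ν cf (DV μ cf (hB hN D c))) (h := hB hN D c)
    (K := fun y y' => CG * pref cf y * Real.exp (-(ρG * (geomT D).dist y y')))
    (fun y y' => by have := pref_nonneg cf y; positivity) (by positivity)
    (fun b hb => DV_DV_hB_support hN hMh1 hP4 c hM8 hR hP5 cf ν μ hb)
    (fun b => abs_DV_DV_hB_le hN c hMh hR hP5 cf ν μ b)
    (fun b hb => (mem_ST D hMh1 hP4 c _).2 (blkV1_mem_QT_of_hB_ne_zero hN D hMh hR hP4 c hb))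
    (fun b => abs_hB_le_one hN D hMh1 hP c b) hG
  -- the operator identity and the sum of the four majorants
  rw [DV_DV_sandwich_eq hN hk hMh1 hP4 hMha c ha₁ hM8 hR2 hpl w hcf ν μ]
  have hT1' := hasL2Majorant_smul (g := geomT D) (blkV1 hN D) hT1 ((cf / (((ℓ + 1 : ℕ) : ℝ)) ^ j0 hMh1 hP4 c) ^ 2)
  have hT2' := hasL2Majorant_smul (g := geomT D) (blkV1 hN D) hT2 (cf / (((ℓ + 1 : ℕ) : ℝ)) ^ j0 hMh1 hP4 c)
  have hT3' := hasL2Majorant_smul (g := geomT D) (blkV1 hN D) hT3 (cf / (((ℓ + 1 : ℕ) : ℝ)) ^ j0 hMh1 hP4 c)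
  refine hasL2Majorant_mono _ (hasL2Majorant_add _ (hasL2Majorant_add _ (hasL2Majorant_add _ hT1' hT2') hT3') hT4) fun y y' => ?_
  -- pointwise comparison of the kernels
  have hj0 : (0 : ℝ) < (((ℓ + 1 : ℕ) : ℝ)) ^ j0 hMh1 hP4 c := by positivity
  have habs : |cf / (((ℓ + 1 : ℕ) : ℝ)) ^ j0 hMh1 hP4 c| = |cf| / (((ℓ + 1 : ℕ) : ℝ)) ^ j0 hMh1 hP4 c := by
    rw [abs_div, abs_of_pos hj0]
  have habs2 : |(cf / (((ℓ + 1 : ℕ) : ℝ)) ^ j0 hMh1 hP4 c) ^ 2| = (cf / (((ℓ + 1 : ℕ) : ℝ)) ^ j0 hMh1 hP4 c) ^ 2 := abs_of_nonneg (sq_nonneg _)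
  rw [habs, habs2]
  by_cases hy : y ∈ ST D hMh1 hP4 c
  · by_cases hy' : y' ∈ ST D hMh1 hP4 c
    · rw [ind_of_mem hy, ind_of_mem hy']
      have hpref := pref_nonneg cf y
      set E : ℝ := Real.exp (-(min ρG (min ρE ρ2) * (geomT D).dist y y')) with hE
      have e2 : Real.exp (-(ρ2 * (geomT D).dist y y')) ≤ E :=
        Real.exp_le_exp.mpr (neg_le_neg (mul_le_mul_of_nonneg_right ((min_le_right _ _).trans (min_le_right _ _)) (hdnn y y')))
      have eE : Real.exp (-(ρE * (geomT D).dist y y')) ≤ E :=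
        Real.exp_le_exp.mpr (neg_le_neg (mul_le_mul_of_nonneg_right ((min_le_right _ _).trans (min_le_left _ _)) (hdnn y y')))
      have eG : Real.exp (-(ρG * (geomT D).dist y y')) ≤ E :=
        Real.exp_le_exp.mpr (neg_le_neg (mul_le_mul_of_nonneg_right (min_le_left _ _) (hdnn y y')))
      -- the scale facts of `□⁺`
      have hs1 := sq_scale_le hL hMh1 hP4 c hR2 hcf hy
      have hs2 : |cf| / (((ℓ + 1 : ℕ) : ℝ)) ^ j0 hMh1 hP4 c * (|cf| * (C1F d ℓ / (8 / 5 * (bigSide ℓ Mh c.1.1 : ℝ))) * pref cf y) ≤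
          (((ℓ + 1 : ℕ) : ℝ)) ^ 4 * C1F d ℓ :=
        (mul_le_mul_of_nonneg_left (lip_scale_le hL hMh1 hP4 c hR2 hcf hy) (by positivity)).trans
          (lin_scale_le hL hMh1 hP4 c hR2 hcf hy hC1)
      have hs4 := sq_size_scale_le hL hMh1 hP4 c hR2 hcf hy hC2X
      calc (cf / (((ℓ + 1 : ℕ) : ℝ)) ^ j0 hMh1 hP4 c) ^ 2 * (1 * 1 * (1 * (C2 * pref cf y * Real.exp (-(ρ2 * (geomT D).dist y y'))))) +
            |cf| / (((ℓ + 1 : ℕ) : ℝ)) ^ j0 hMh1 hP4 c * (1 * 1 * (|cf| * (C1F d ℓ / (8 / 5 * (bigSide ℓ Mh c.1.1 : ℝ))) *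
              (CE * pref cf y * Real.exp (-(ρE * (geomT D).dist y y'))))) +
            |cf| / (((ℓ + 1 : ℕ) : ℝ)) ^ j0 hMh1 hP4 c * (1 * 1 * (|cf| * (C1F d ℓ / (8 / 5 * (bigSide ℓ Mh c.1.1 : ℝ))) *
              (CE * pref cf y * Real.exp (-(ρE * (geomT D).dist y y'))))) +
            1 * 1 * (cf ^ 2 * (C2X d ℓ / (8 / 5 * (bigSide ℓ Mh c.1.1 : ℝ)) ^ 2) * (CG * pref cf y * Real.exp (-(ρG * (geomT D).dist y y'))))
          ≤ (cf / (((ℓ + 1 : ℕ) : ℝ)) ^ j0 hMh1 hP4 c) ^ 2 * (1 * 1 * (1 * (C2 * pref cf y * E))) +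
            |cf| / (((ℓ + 1 : ℕ) : ℝ)) ^ j0 hMh1 hP4 c * (1 * 1 * (|cf| * (C1F d ℓ / (8 / 5 * (bigSide ℓ Mh c.1.1 : ℝ))) * (CE * pref cf y * E))) +
            |cf| / (((ℓ + 1 : ℕ) : ℝ)) ^ j0 hMh1 hP4 c * (1 * 1 * (|cf| * (C1F d ℓ / (8 / 5 * (bigSide ℓ Mh c.1.1 : ℝ))) * (CE * pref cf y * E))) +
            1 * 1 * (cf ^ 2 * (C2X d ℓ / (8 / 5 * (bigSide ℓ Mh c.1.1 : ℝ)) ^ 2) * (CG * pref cf y * E)) := by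
            gcongr
        _ = C2 * ((cf / (((ℓ + 1 : ℕ) : ℝ)) ^ j0 hMh1 hP4 c) ^ 2 * pref cf y) * E +
            CE * (|cf| / (((ℓ + 1 : ℕ) : ℝ)) ^ j0 hMh1 hP4 c * (|cf| * (C1F d ℓ / (8 / 5 * (bigSide ℓ Mh c.1.1 : ℝ))) * pref cf y)) * E +
            CE * (|cf| / (((ℓ + 1 : ℕ) : ℝ)) ^ j0 hMh1 hP4 c * (|cf| * (C1F d ℓ / (8 / 5 * (bigSide ℓ Mh c.1.1 : ℝ))) * pref cf y)) * E +
            CG * (cf ^ 2 * (C2X d ℓ / (8 / 5 * (bigSide ℓ Mh c.1.1 : ℝ)) ^ 2) * pref cf y) * E := by ring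
        _ ≤ C2 * (((ℓ + 1 : ℕ) : ℝ)) ^ 4 * E + CE * ((((ℓ + 1 : ℕ) : ℝ)) ^ 4 * C1F d ℓ) * E + CE * ((((ℓ + 1 : ℕ) : ℝ)) ^ 4 * C1F d ℓ) * E +
            CG * ((((ℓ + 1 : ℕ) : ℝ)) ^ 4 * C2X d ℓ) * E := by
            gcongr
        _ = 1 * 1 * (((((ℓ + 1 : ℕ) : ℝ)) ^ 4 * C2 + ((((ℓ + 1 : ℕ) : ℝ)) ^ 4 * C1F d ℓ * CE + (((ℓ + 1 : ℕ) : ℝ)) ^ 4 * C1F d ℓ * CE) +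
            (((ℓ + 1 : ℕ) : ℝ)) ^ 4 * C2X d ℓ * CG) * E) := by ring
    · have hi : ind (ST D hMh1 hP4 c) y' = 0 := ind_of_not_mem hy'
      rw [hi]
      simp
  · have hi : ind (ST D hMh1 hP4 c) y = 0 := ind_of_not_mem hy
    rw [hi]
    simp

end Leg

end Literature.MathematicalPhysics.QuantumFieldTheory.Balaban1983to89.B6RandomWalkL2Grad2LegV1
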